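import Summits.HubbardSuperconductivity.HubbardSuperconductivity.Theorems.BalabanIRBirSliceXYOrderRPFourier
import Summits.HubbardSuperconductivity.HubbardSuperconductivity.Theorems.BalabanIRBirSliceXYOrderRPSums
import HarnessLib

/-!
# Crux `BirComplexStableXYR` (stmt-HubbardSuperconductivity-14845): the effective resistance of the
# anisotropic space-time torus `(ℤ/L)² × ℤ/M`, `L ≤ M`, between two sites of a time slice is bounded

Support file (prover seat 0, route BalabanIR) for the restated engine
`…Theses.BalabanIR.BirComplexStableXYR`, second of three files proving the GAUSSIAN BACKBONE of the
crux (`…RSpinWave`).  The lattice-analytic input of spin-wave theory on the elongated torus: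

  `(u(x,t) − u(y,t))² ≤ 64 · D(u)`,  `D(u) = Σ_s [(u_s − u_{s+E₁})² + (u_s − u_{s+E₂})² + (u_s − u_{s+E₃})²]`

for every real field `u` on `(ℤ/L)² × ℤ/M` with `2 ≤ L ≤ M` and all `x, y` in the same time slice
(`res_resistance_bound`, and `res_resistance_bound_zmod` for the crux's `TorusSite 2 L × ZMod M`),
i.e. the `H⁻¹`-norm of `δ_{(x,t)} − δ_{(y,t)}` is at most `8`: by Fourier inversion on the product torus,
the gradient symbol `2(ε_L(k) + ε_M(q))`, Cauchy–Schwarz, and the anisotropic lattice sum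
`Σ_{k≠0}Σ_q (ε_L(k)+ε_M(q))⁻¹ ≤ 32 L²M` (`BirSliceXY.dispersion_sum_bound`) — the modes with zero spatial
momentum, which soften as `M → ∞`, do not see equal-time differences.  No definitions. [folklore]
-/

noncomputable section

namespace Summit.HubbardSuperconductivity.HubbardSuperconductivity.Theorems

namespace BirSpinWave

open Finset Literature.Probability.LatticeModels
open _root_.Complex
open scoped ComplexConjugate BigOperators

variable {L M : ℕ} [NeZero L] [NeZero M]

/-- The product character is multiplicative in the site. [folklore] -/
theorem res_char_add (kq p p' : TorusSite 2 L × TorusSite 1 M) :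
    torusChar kq.1 (p + p').1 * torusChar kq.2 (p + p').2 =
      (torusChar kq.1 p.1 * torusChar kq.2 p.2) * (torusChar kq.1 p'.1 * torusChar kq.2 p'.2) := by
  rw [Prod.fst_add, Prod.snd_add, torusChar_add_right, torusChar_add_right]; ring

/-- The product character of a difference. [folklore] -/
theorem res_char_sub (kq p p' : TorusSite 2 L × TorusSite 1 M) :
    torusChar kq.1 (p - p').1 * torusChar kq.2 (p - p').2 =
      (torusChar kq.1 p.1 * torusChar kq.2 p.2) * conj (torusChar kq.1 p'.1 * torusChar kq.2 p'.2) := by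
  rw [Prod.fst_sub, Prod.snd_sub, torusChar_sub_right, torusChar_sub_right, map_mul]; ring

/-- The product character has norm one. [folklore] -/
theorem res_char_norm (kq p : TorusSite 2 L × TorusSite 1 M) :
    ‖torusChar kq.1 p.1 * torusChar kq.2 p.2‖ = 1 := by
  rw [norm_mul, norm_torusChar, norm_torusChar, mul_one]

/-- **Orthogonality on the product torus**: `Σ_{kq} χ_{kq}(p) = L²M δ_{p,0}`. [folklore] -/
theorem res_sum_char (p : TorusSite 2 L × TorusSite 1 M) :
    ∑ kq : TorusSite 2 L × TorusSite 1 M, torusChar kq.1 p.1 * torusChar kq.2 p.2 =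
      if p = 0 then ((L : ℂ) ^ 2 * (M : ℂ) ^ 1) else 0 := by
  rw [Fintype.sum_prod_type]
  simp only []
  rw [← Finset.sum_mul_sum, sum_torusChar_left, sum_torusChar_left]
  by_cases hp : p = 0
  · simp [hp]
  · rw [if_neg hp]
    have : p.1 ≠ 0 ∨ p.2 ≠ 0 := by
      by_contra h
      push Not at h
      exact hp (Prod.ext h.1 h.2)
    rcases this with h1 | h2
    · rw [if_neg h1, zero_mul]
    · rw [if_neg h2, mul_zero]

/-- **Fourier inversion at a point**: `Σ_{kq} û(kq) conj χ_{kq}(p₀) = L²M u(p₀)` for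
`û(kq) = Σ_p u_p χ_{kq}(p)`. [folklore] -/
theorem res_inversion_at (u : TorusSite 2 L × TorusSite 1 M → ℂ) (p₀ : TorusSite 2 L × TorusSite 1 M) :
    ∑ kq : TorusSite 2 L × TorusSite 1 M,
        (∑ p, u p * (torusChar kq.1 p.1 * torusChar kq.2 p.2)) *
          conj (torusChar kq.1 p₀.1 * torusChar kq.2 p₀.2) =
      ((L : ℂ) ^ 2 * (M : ℂ) ^ 1) * u p₀ := by
  have h1 : ∀ kq : TorusSite 2 L × TorusSite 1 M,
      (∑ p, u p * (torusChar kq.1 p.1 * torusChar kq.2 p.2)) *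
          conj (torusChar kq.1 p₀.1 * torusChar kq.2 p₀.2) =
        ∑ p, u p * (torusChar kq.1 (p - p₀).1 * torusChar kq.2 (p - p₀).2) := by
    intro kq
    rw [Finset.sum_mul]
    refine Finset.sum_congr rfl fun p _ => ?_
    rw [res_char_sub]; ring
  simp_rw [h1]
  rw [Finset.sum_comm]
  simp_rw [← Finset.mul_sum, res_sum_char, sub_eq_zero, mul_ite, mul_zero]
  rw [Finset.sum_ite_eq']
  simp [mul_comm]

/-- **Shift theorem**: `Σ_p u(p + E) χ_{kq}(p) = conj χ_{kq}(E) · û(kq)`. [folklore] -/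
theorem res_shift_transform (u : TorusSite 2 L × TorusSite 1 M → ℂ) (E kq : TorusSite 2 L × TorusSite 1 M) :
    ∑ p, u (p + E) * (torusChar kq.1 p.1 * torusChar kq.2 p.2) =
      conj (torusChar kq.1 E.1 * torusChar kq.2 E.2) * ∑ p, u p * (torusChar kq.1 p.1 * torusChar kq.2 p.2) := by
  have h := Equiv.sum_comp (Equiv.addRight E)
    (fun p => u p * (torusChar kq.1 (p - E).1 * torusChar kq.2 (p - E).2))
  simp only [Equiv.coe_addRight, add_sub_cancel_right] at h
  rw [h, Finset.mul_sum]
  refine Finset.sum_congr rfl fun p _ => ?_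
  rw [res_char_sub]; ring

/-- Transform of a difference field: `Σ_p (u_p − u_{p+E}) χ_{kq}(p) = (1 − conj χ_{kq}(E)) û(kq)`.
[folklore] -/
theorem res_diff_transform (u : TorusSite 2 L × TorusSite 1 M → ℂ) (E kq : TorusSite 2 L × TorusSite 1 M) :
    ∑ p, (u p - u (p + E)) * (torusChar kq.1 p.1 * torusChar kq.2 p.2) =
      (1 - conj (torusChar kq.1 E.1 * torusChar kq.2 E.2)) *
        ∑ p, u p * (torusChar kq.1 p.1 * torusChar kq.2 p.2) := by
  simp_rw [sub_mul]
  rw [Finset.sum_sub_distrib, res_shift_transform]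
  ring

/-- `‖1 − conj z‖² = 2(1 − Re z)` for `‖z‖ = 1`. [folklore] -/
theorem res_norm_one_sub_conj_sq {z : ℂ} (hz : ‖z‖ = 1) : ‖1 - conj z‖ ^ 2 = 2 * (1 - z.re) := by
  have h2 : z.re ^ 2 + z.im ^ 2 = 1 := by
    have := Complex.sq_norm z
    rw [hz, Complex.normSq_apply] at this
    nlinarith [this]
  rw [← Complex.normSq_eq_norm_sq, Complex.normSq_apply]
  simp only [Complex.sub_re, Complex.one_re, Complex.conj_re, Complex.sub_im, Complex.one_im,
    Complex.conj_im]
  nlinarith [h2]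

/-- **Plancherel for a real field** on `(ℤ/L)² × (ℤ/M)¹`: `Σ_{kq} |û(kq)|² = L²M Σ_p u_p²`. [folklore] -/
theorem res_plancherel_real (u : TorusSite 2 L × TorusSite 1 M → ℝ) :
    ∑ kq : TorusSite 2 L × TorusSite 1 M,
        ‖∑ p, (u p : ℂ) * (torusChar kq.1 p.1 * torusChar kq.2 p.2)‖ ^ 2 =
      (L : ℝ) ^ 2 * M * ∑ p, u p ^ 2 := by
  rw [BirSliceXY.sum_norm_sq_boxMode (fun p => (u p : ℂ))]
  simp [Complex.norm_real, pow_one]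

/-- Real part of the product character at the three unit steps (`2 ≤ L`, `2 ≤ M`). [folklore] -/
theorem res_char_unit_re (hL : 2 ≤ L) (hM : 2 ≤ M) (kq : TorusSite 2 L × TorusSite 1 M) :
    (torusChar kq.1 (Pi.single 0 1) * torusChar kq.2 (0 : TorusSite 1 M)).re =
        Real.cos (latticeMomentum L kq.1 0) ∧
      (torusChar kq.1 (Pi.single 1 1) * torusChar kq.2 (0 : TorusSite 1 M)).re =
        Real.cos (latticeMomentum L kq.1 1) ∧
      (torusChar kq.1 (0 : TorusSite 2 L) * torusChar kq.2 (Pi.single 0 1)).re =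
        Real.cos (latticeMomentum M kq.2 0) := by
  refine ⟨?_, ?_, ?_⟩
  · rw [torusChar_zero_right, mul_one, torusChar_single hL, Complex.exp_ofReal_mul_I_re]
  · rw [torusChar_zero_right, mul_one, torusChar_single hL, Complex.exp_ofReal_mul_I_re]
  · rw [torusChar_zero_right, one_mul, torusChar_single hM, Complex.exp_ofReal_mul_I_re]

/-- One direction of the gradient symbol: `Σ_{kq} 2(1 − Re χ_{kq}(E)) |û(kq)|² = L²M Σ_p (u_p − u_{p+E})²`.
[folklore] -/
theorem res_gradient_dir (u : TorusSite 2 L × TorusSite 1 M → ℝ) (E : TorusSite 2 L × TorusSite 1 M) :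
    ∑ kq : TorusSite 2 L × TorusSite 1 M,
        2 * (1 - (torusChar kq.1 E.1 * torusChar kq.2 E.2).re) *
          ‖∑ p, (u p : ℂ) * (torusChar kq.1 p.1 * torusChar kq.2 p.2)‖ ^ 2 =
      (L : ℝ) ^ 2 * M * ∑ p, (u p - u (p + E)) ^ 2 := by
  have h := res_plancherel_real (L := L) (M := M) (fun p => u p - u (p + E))
  rw [← h]
  refine Finset.sum_congr rfl fun kq _ => ?_
  have hd := res_diff_transform (fun p => (u p : ℂ)) E kq
  push_cast
  rw [hd, norm_mul, mul_pow, res_norm_one_sub_conj_sq (res_char_norm kq E)]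

/-- **The gradient symbol** (`2 ≤ L`, `2 ≤ M`):
`Σ_{kq} 2(ε_L(k) + ε_M(q)) |û(kq)|² = L²M · D(u)` with `ε` the tree's `dispersion ∘ latticeMomentum`
and `D` the Dirichlet form along the three unit steps. [folklore] -/
theorem res_gradient_symbol (hL : 2 ≤ L) (hM : 2 ≤ M) (u : TorusSite 2 L × TorusSite 1 M → ℝ) :
    ∑ kq : TorusSite 2 L × TorusSite 1 M,
        2 * (dispersion (latticeMomentum L kq.1) + dispersion (latticeMomentum M kq.2)) *
          ‖∑ p, (u p : ℂ) * (torusChar kq.1 p.1 * torusChar kq.2 p.2)‖ ^ 2 =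
      (L : ℝ) ^ 2 * M * ∑ p : TorusSite 2 L × TorusSite 1 M,
        ((u p - u (p + (Pi.single 0 1, 0))) ^ 2 + (u p - u (p + (Pi.single 1 1, 0))) ^ 2 +
          (u p - u (p + (0, Pi.single 0 1))) ^ 2) := by
  have h1 := res_gradient_dir u ((Pi.single 0 1, 0) : TorusSite 2 L × TorusSite 1 M)
  have h2 := res_gradient_dir u ((Pi.single 1 1, 0) : TorusSite 2 L × TorusSite 1 M)
  have h3 := res_gradient_dir u ((0, Pi.single 0 1) : TorusSite 2 L × TorusSite 1 M)
  simp only [Finset.sum_add_distrib, mul_add]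
  rw [← h1, ← h2, ← h3, ← Finset.sum_add_distrib, ← Finset.sum_add_distrib]
  refine Finset.sum_congr rfl fun kq _ => ?_
  obtain ⟨e1, e2, e3⟩ := res_char_unit_re hL hM kq
  rw [e1, e2, e3]
  unfold dispersion
  rw [Fin.sum_univ_two, Fin.sum_univ_one]
  ring

/-- **The pairing**: `L²M (u(x,t) − u(y,t)) = Σ_{kq} û(kq) (conj χ_{kq}(x,t) − conj χ_{kq}(y,t))`.
[folklore] -/
theorem res_pairing (u : TorusSite 2 L × TorusSite 1 M → ℝ) (x y : TorusSite 2 L) (t : TorusSite 1 M) :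
    ((L : ℂ) ^ 2 * (M : ℂ) ^ 1) * (((u (x, t) - u (y, t) : ℝ)) : ℂ) =
      ∑ kq : TorusSite 2 L × TorusSite 1 M,
        (∑ p, (u p : ℂ) * (torusChar kq.1 p.1 * torusChar kq.2 p.2)) *
          (conj (torusChar kq.1 x * torusChar kq.2 t) - conj (torusChar kq.1 y * torusChar kq.2 t)) := by
  have hx := res_inversion_at (fun p => (u p : ℂ)) (x, t)
  have hy := res_inversion_at (fun p => (u p : ℂ)) (y, t)
  simp_rw [mul_sub]
  rw [Finset.sum_sub_distrib, hx, hy]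
  push_cast
  ring

/-- The pairing vector vanishes at zero spatial momentum and has norm at most `2`. [folklore] -/
theorem res_pairing_vector_bound (k : TorusSite 2 L) (q : TorusSite 1 M) (x y : TorusSite 2 L)
    (t : TorusSite 1 M) :
    ‖conj (torusChar k x * torusChar q t) - conj (torusChar k y * torusChar q t)‖ ≤ 2 ∧
      (k = 0 → conj (torusChar k x * torusChar q t) - conj (torusChar k y * torusChar q t) = 0) := by
  refine ⟨?_, fun h0 => ?_⟩
  · calc ‖conj (torusChar k x * torusChar q t) - conj (torusChar k y * torusChar q t)‖
        ≤ ‖conj (torusChar k x * torusChar q t)‖ + ‖conj (torusChar k y * torusChar q t)‖ :=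
          norm_sub_le _ _
      _ = 2 := by
          rw [Complex.norm_conj, Complex.norm_conj, res_char_norm (k, q) (x, t),
            res_char_norm (k, q) (y, t)]
          norm_num
  · rw [h0, torusChar_zero_left, torusChar_zero_left, sub_self]

/-- Cauchy–Schwarz for an iterated finite sum: `(ΣΣ r)² ≤ (ΣΣ f)(ΣΣ g)` when `r² ≤ f g`, `f, g ≥ 0`.
[folklore] -/
theorem res_cauchySchwarz_iter {α β : Type*} (s : Finset α) (t : Finset β) (r f g : α → β → ℝ)
    (hf : ∀ a ∈ s, ∀ b ∈ t, 0 ≤ f a b) (hg : ∀ a ∈ s, ∀ b ∈ t, 0 ≤ g a b)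
    (h : ∀ a ∈ s, ∀ b ∈ t, r a b ^ 2 ≤ f a b * g a b) :
    (∑ a ∈ s, ∑ b ∈ t, r a b) ^ 2 ≤ (∑ a ∈ s, ∑ b ∈ t, f a b) * (∑ a ∈ s, ∑ b ∈ t, g a b) := by
  rw [← Finset.sum_product', ← Finset.sum_product', ← Finset.sum_product']
  refine Finset.sum_sq_le_sum_mul_sum_of_sq_le_mul _ (fun ab hab => ?_) (fun ab hab => ?_)
    (fun ab hab => ?_)
  · exact hf ab.1 (Finset.mem_product.1 hab).1 ab.2 (Finset.mem_product.1 hab).2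
  · exact hg ab.1 (Finset.mem_product.1 hab).1 ab.2 (Finset.mem_product.1 hab).2
  · exact h ab.1 (Finset.mem_product.1 hab).1 ab.2 (Finset.mem_product.1 hab).2

/-- **Effective resistance bound on the anisotropic torus** (`2 ≤ L ≤ M`): for every real field `u`
on `(ℤ/L)² × (ℤ/M)¹` and all `x, y` in the time slice `t`,
`(u(x,t) − u(y,t))² ≤ 64 · Σ_s [(u_s − u_{s+E₁})² + (u_s − u_{s+E₂})² + (u_s − u_{s+E₃})²]`. [folklore] -/
theorem res_resistance_bound (hL : 2 ≤ L) (hLM : L ≤ M) (u : TorusSite 2 L × TorusSite 1 M → ℝ)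
    (x y : TorusSite 2 L) (t : TorusSite 1 M) :
    (u (x, t) - u (y, t)) ^ 2 ≤
      64 * ∑ p : TorusSite 2 L × TorusSite 1 M,
        ((u p - u (p + (Pi.single 0 1, 0))) ^ 2 + (u p - u (p + (Pi.single 1 1, 0))) ^ 2 +
          (u p - u (p + (0, Pi.single 0 1))) ^ 2) := by
  have hM : 2 ≤ M := hL.trans hLM
  have hLpos : (0 : ℝ) < L := by exact_mod_cast Nat.pos_of_ne_zero (NeZero.ne L)
  have hMpos : (0 : ℝ) < M := by exact_mod_cast Nat.pos_of_ne_zero (NeZero.ne M)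
  have hNpos : (0 : ℝ) < (L : ℝ) ^ 2 * M := by positivity
  -- abbreviations
  set uh : TorusSite 2 L → TorusSite 1 M → ℂ := fun k q =>
    ∑ p, (u p : ℂ) * (torusChar k p.1 * torusChar q p.2) with huh
  set dv : TorusSite 2 L → TorusSite 1 M → ℂ := fun k q =>
    conj (torusChar k x * torusChar q t) - conj (torusChar k y * torusChar q t) with hdv
  set w : TorusSite 2 L → TorusSite 1 M → ℝ := fun k q =>
    2 * (dispersion (latticeMomentum L k) + dispersion (latticeMomentum M q)) with hw
  set D : ℝ := ∑ p : TorusSite 2 L × TorusSite 1 M,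
    ((u p - u (p + (Pi.single 0 1, 0))) ^ 2 + (u p - u (p + (Pi.single 1 1, 0))) ^ 2 +
      (u p - u (p + (0, Pi.single 0 1))) ^ 2) with hD
  have hDnn : 0 ≤ D := Finset.sum_nonneg fun p _ => by positivity
  have hwnn : ∀ k q, 0 ≤ w k q := fun k q => by
    simp only [hw]
    have := dispersion_nonneg (latticeMomentum L k)
    have := dispersion_nonneg (latticeMomentum M q)
    linarith
  -- step 1: `L²M |u_x - u_y| ≤ Σ_{k ≠ 0} Σ_q ‖û‖ ‖d‖`
  have hpair : ((((L : ℝ) ^ 2 * M) * (u (x, t) - u (y, t)) : ℝ) : ℂ) = ∑ k, ∑ q, uh k q * dv k q := by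
    have := res_pairing u x y t
    rw [Fintype.sum_prod_type] at this
    push_cast at this ⊢
    rw [← this]; ring
  have hstep1 : ((L : ℝ) ^ 2 * M) * |u (x, t) - u (y, t)| ≤
      ∑ k ∈ Finset.univ.erase (0 : TorusSite 2 L), ∑ q : TorusSite 1 M, ‖uh k q‖ * ‖dv k q‖ := by
    have h1 : ((L : ℝ) ^ 2 * M) * |u (x, t) - u (y, t)| =
        ‖((((L : ℝ) ^ 2 * M) * (u (x, t) - u (y, t)) : ℝ) : ℂ)‖ := by
      rw [Complex.norm_real, Real.norm_eq_abs, abs_mul, abs_of_pos hNpos]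
    rw [h1, hpair]
    refine (norm_sum_le _ _).trans ?_
    have h2 : ∀ k, ‖∑ q, uh k q * dv k q‖ ≤ ∑ q, ‖uh k q‖ * ‖dv k q‖ := fun k => by
      refine (norm_sum_le _ _).trans (le_of_eq ?_)
      simp_rw [norm_mul]
    refine (Finset.sum_le_sum fun k _ => h2 k).trans (le_of_eq ?_)
    rw [← Finset.add_sum_erase _ _ (Finset.mem_univ (0 : TorusSite 2 L))]
    have h0 : ∑ q : TorusSite 1 M, ‖uh 0 q‖ * ‖dv 0 q‖ = 0 := by
      refine Finset.sum_eq_zero fun q _ => ?_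
      have hz : dv 0 q = 0 := (res_pairing_vector_bound 0 q x y t).2 rfl
      rw [hz, norm_zero, mul_zero]
    rw [h0, zero_add]
  -- step 2: Cauchy–Schwarz with the weight `w > 0` on `k ≠ 0`
  have hwpos : ∀ k ∈ Finset.univ.erase (0 : TorusSite 2 L), ∀ q : TorusSite 1 M, 0 < w k q := by
    intro k hk q
    have hk0 : k ≠ 0 := Finset.ne_of_mem_erase hk
    have hμ1 : (1 : ℝ) ≤ (max (min (k 0).val (L - (k 0).val)) (min (k 1).val (L - (k 1).val)) : ℕ) := by
      exact_mod_cast BirSliceXY.one_le_maxnorm hk0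
    have hε := BirSliceXY.maxnorm_sq_le_dispersion k
    have h4 : 0 < 4 * ((max (min (k 0).val (L - (k 0).val)) (min (k 1).val (L - (k 1).val)) : ℕ) : ℝ) ^ 2 /
        (L : ℝ) ^ 2 := by positivity
    have hεt : 0 ≤ dispersion (latticeMomentum M q) := dispersion_nonneg _
    simp only [hw]
    linarith
  have hCS : (∑ k ∈ Finset.univ.erase (0 : TorusSite 2 L), ∑ q : TorusSite 1 M, ‖uh k q‖ * ‖dv k q‖) ^ 2 ≤
      (∑ k ∈ Finset.univ.erase (0 : TorusSite 2 L), ∑ q : TorusSite 1 M, w k q * ‖uh k q‖ ^ 2) *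
        (∑ k ∈ Finset.univ.erase (0 : TorusSite 2 L), ∑ q : TorusSite 1 M, ‖dv k q‖ ^ 2 / w k q) := by
    refine res_cauchySchwarz_iter _ _ (fun k q => ‖uh k q‖ * ‖dv k q‖) (fun k q => w k q * ‖uh k q‖ ^ 2)
      (fun k q => ‖dv k q‖ ^ 2 / w k q) (fun k hk q _ => ?_) (fun k hk q _ => ?_) (fun k hk q _ => ?_)
    · have := hwpos k hk q
      positivity
    · have := hwpos k hk q
      positivity
    · have hw0 := hwpos k hk q
      rw [mul_pow]
      field_simp
      ring_nf
      exact le_rfl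
  -- step 3: the two factors
  have hF : ∑ k ∈ Finset.univ.erase (0 : TorusSite 2 L), ∑ q : TorusSite 1 M, w k q * ‖uh k q‖ ^ 2 ≤
      ((L : ℝ) ^ 2 * M) * D := by
    have hall : ∑ k : TorusSite 2 L, ∑ q : TorusSite 1 M, w k q * ‖uh k q‖ ^ 2 = ((L : ℝ) ^ 2 * M) * D := by
      have := res_gradient_symbol hL hM u
      rw [Fintype.sum_prod_type] at this
      simpa only [hw, huh, hD] using this
    rw [← hall]
    refine Finset.sum_le_sum_of_subset_of_nonneg (Finset.erase_subset _ _) fun k _ _ => ?_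
    exact Finset.sum_nonneg fun q _ => mul_nonneg (hwnn k q) (sq_nonneg _)
  have hG : ∑ k ∈ Finset.univ.erase (0 : TorusSite 2 L), ∑ q : TorusSite 1 M, ‖dv k q‖ ^ 2 / w k q ≤
      64 * ((L : ℝ) ^ 2 * M) := by
    calc ∑ k ∈ Finset.univ.erase (0 : TorusSite 2 L), ∑ q : TorusSite 1 M, ‖dv k q‖ ^ 2 / w k q
        ≤ ∑ k ∈ Finset.univ.erase (0 : TorusSite 2 L), ∑ q : TorusSite 1 M,
            2 * (1 / (dispersion (latticeMomentum L k) + dispersion (latticeMomentum M q))) := by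
          refine Finset.sum_le_sum fun k hk => Finset.sum_le_sum fun q _ => ?_
          have hw0 := hwpos k hk q
          have hd2 := (res_pairing_vector_bound k q x y t).1
          have hd4 : ‖dv k q‖ ^ 2 ≤ 4 := by
            have h0 : 0 ≤ ‖dv k q‖ := norm_nonneg _
            have h2' : ‖dv k q‖ ≤ 2 := hd2
            nlinarith
          have hεpos : 0 < dispersion (latticeMomentum L k) + dispersion (latticeMomentum M q) := by
            simp only [hw] at hw0; linarith
          rw [div_le_iff₀ hw0]
          simp only [hw]
          rw [show 2 * (1 / (dispersion (latticeMomentum L k) + dispersion (latticeMomentum M q))) *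
              (2 * (dispersion (latticeMomentum L k) + dispersion (latticeMomentum M q))) = 4 by
            field_simp; ring]
          exact hd4
      _ = 2 * ∑ k ∈ Finset.univ.erase (0 : TorusSite 2 L), ∑ q : TorusSite 1 M,
            1 / (dispersion (latticeMomentum L k) + dispersion (latticeMomentum M q)) := by
          rw [Finset.mul_sum]
          refine Finset.sum_congr rfl fun k _ => ?_
          rw [Finset.mul_sum]
      _ ≤ 2 * (32 * (L : ℝ) ^ 2 * M) :=
          mul_le_mul_of_nonneg_left (BirSliceXY.dispersion_sum_bound hLM) (by norm_num)
      _ = 64 * ((L : ℝ) ^ 2 * M) := by ring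
  -- step 4: combine
  have hsq : (((L : ℝ) ^ 2 * M) * |u (x, t) - u (y, t)|) ^ 2 ≤ (((L : ℝ) ^ 2 * M) * D) * (64 * ((L : ℝ) ^ 2 * M)) := by
    have h0 : 0 ≤ ((L : ℝ) ^ 2 * M) * |u (x, t) - u (y, t)| := by positivity
    calc (((L : ℝ) ^ 2 * M) * |u (x, t) - u (y, t)|) ^ 2
        ≤ (∑ k ∈ Finset.univ.erase (0 : TorusSite 2 L), ∑ q : TorusSite 1 M, ‖uh k q‖ * ‖dv k q‖) ^ 2 :=
          pow_le_pow_left₀ h0 hstep1 2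
      _ ≤ _ := hCS
      _ ≤ (((L : ℝ) ^ 2 * M) * D) * (64 * ((L : ℝ) ^ 2 * M)) := by
          refine mul_le_mul hF hG ?_ (by positivity)
          exact Finset.sum_nonneg fun k hk => Finset.sum_nonneg fun q _ =>
            div_nonneg (sq_nonneg _) (hwpos k hk q).le
  have habs : (((L : ℝ) ^ 2 * M) * |u (x, t) - u (y, t)|) ^ 2 =
      ((L : ℝ) ^ 2 * M) ^ 2 * (u (x, t) - u (y, t)) ^ 2 := by
    rw [mul_pow, sq_abs]
  rw [habs] at hsq
  have hN2 : 0 < ((L : ℝ) ^ 2 * M) ^ 2 := by positivity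
  have key : ((L : ℝ) ^ 2 * M) ^ 2 * ((u (x, t) - u (y, t)) ^ 2 - 64 * D) ≤ 0 := by nlinarith [hsq]
  have key2 : (u (x, t) - u (y, t)) ^ 2 - 64 * D ≤ 0 := by
    by_contra hcon
    push Not at hcon
    have := mul_pos hN2 hcon
    linarith
  linarith

/-- **Effective resistance bound, `ZMod` form** (`2 ≤ L ≤ M`): for every real field `u` on the crux's
space-time torus `TorusSite 2 L × ZMod M` and all `x, y` in the time slice `t`,
`(u(x,t) − u(y,t))² ≤ 64 · Σ_s [(u_s − u_{s+(e₁,0)})² + (u_s − u_{s+(e₂,0)})² + (u_s − u_{s+(0,1)})²]`.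
[folklore] -/
theorem res_resistance_bound_zmod (hL : 2 ≤ L) (hLM : L ≤ M) (u : TorusSite 2 L × ZMod M → ℝ)
    (x y : TorusSite 2 L) (t : ZMod M) :
    (u (x, t) - u (y, t)) ^ 2 ≤
      64 * ∑ s : TorusSite 2 L × ZMod M,
        ((u s - u (s + (![1, 0], 0))) ^ 2 + (u s - u (s + (![0, 1], 0))) ^ 2 +
          (u s - u (s + (0, 1))) ^ 2) := by
  -- relabel `ℤ/M ≃ (ℤ/M)¹`
  set e : ZMod M ≃ TorusSite 1 M := (Equiv.funUnique (Fin 1) (ZMod M)).symm with he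
  set eΛ : (TorusSite 2 L × ZMod M) ≃ (TorusSite 2 L × TorusSite 1 M) :=
    (Equiv.refl (TorusSite 2 L)).prodCongr e with heΛ
  set u' : TorusSite 2 L × TorusSite 1 M → ℝ := fun p => u (eΛ.symm p) with hu'
  have h1 : ![(1 : ZMod L), 0] = Pi.single (0 : Fin 2) (1 : ZMod L) := by
    funext i; fin_cases i <;> simp
  have h2 : ![(0 : ZMod L), 1] = Pi.single (1 : Fin 2) (1 : ZMod L) := by
    funext i; fin_cases i <;> simp
  have hsymm : ∀ p : TorusSite 2 L × TorusSite 1 M, eΛ.symm p = (p.1, p.2 0) := fun p => rfl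
  have hux : u' (x, e t) = u (x, t) := by simp [hu', hsymm, he]
  have huy : u' (y, e t) = u (y, t) := by simp [hu', hsymm, he]
  have hmain := res_resistance_bound hL hLM u' x y (e t)
  rw [hux, huy] at hmain
  refine hmain.trans (le_of_eq ?_)
  congr 1
  refine (Fintype.sum_equiv eΛ _ _ fun s => ?_).symm
  obtain ⟨s1, s2⟩ := s
  have hs : eΛ (s1, s2) = (s1, e s2) := rfl
  have he2 : ∀ t' : ZMod M, e t' 0 = t' := fun t' => rfl
  simp only [hu', hsymm, hs, Prod.mk_add_mk, Pi.add_apply, he2, add_zero, h1, h2, Pi.single_eq_same]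

end BirSpinWave

end Summit.HubbardSuperconductivity.HubbardSuperconductivity.Theorems
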